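import Literature.AnabelianGeometry.SemiGraphs.TemperedTopCyclicLocalTransport
import HarnessLib

/-!
# [SemiAnbd] Thm 3.7 (iii) / Cor 3.9 (R3c) for TOPOLOGICALLY CYCLIC edge groups on a TREE-shaped `𝔾`:
# a fixed branch is transported back to the START of any fixed tree path with closed base walk

Mochizuki, *Semi-graphs of anabelioids*, Publ. RIMS **42** (2006), §3 Theorem 3.7 (iii), proof p. 41,
third paragraph, with the author's *Comments* (2020) (6)(b); Corollary 3.9, proof p. 43 l. 13 (the
cell's step (R3c), FACT-LIST rows F-2772 `EdgeLikeCentralizerAt` / F-2773 `EdgeLikeCentralizer`)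
[cite: MochizukiSemiAnbd2006, Thm 3.7(iii) p.41].

PROOF-ONLY (cell abc-iut, block F, seat abc-iut-f-175 gen 3; brick (B) of «CONFINED@TOP-CYCLIC-TREES»;
no definition, no named fact).  **PATH TRANSPORT** (`exists_fixed_branch_of_closed_baseWalk`): at one
level `n` of a Galois tower over a `𝒢` whose underlying semi-graph has ACYCLIC barycentric subdivision
and ALL of whose edge groups are topologically cyclic, let `p` be a path of the subdivision of `𝔾̃_n`
from a vertex `a` to a vertex `z`, both over the base vertex `w`, every node of which is fixed by the
subgroup `C` of `π₁^temp(𝒢)`, and let `δ` be a branch at `z` with `C`-fixed edge.  Then `C` fixes the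
edge of a branch AT `a` over the base branch of `δ`.  Proof by strong induction on the length: the
FIRST return of `p` to a vertex `u₀` over `w` happens through a branch over the SAME base branch as the
first step of `p` (in the acyclic base subdivision the point of `w` separates its branch-points:
`SimpleGraph.IsAcyclic.path_unique`), the induction hypothesis transports `δ` to `u₀`, and the one-level
local transport of brick (A) (`GaloisLevelData.exists_fixed_branch_transport`, switch-freeness of cyclic
edge stabilisers) carries it from `u₀` to `a`.  This is the step at which a vertex of INFINITE valence
cannot let the path «drift» through ever-farther branches (abc-iut-f-172 gen 5's residual (II-b)).

Honest framing: the ∀-closures F-2773 / F-1732 are NOT claimed; nothing here bears on [IUTchIII]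
Cor. 3.12; typed ≠ proved elsewhere.
-/

namespace Literature.AnabelianGeometry.SemiGraphs

open CategoryTheory Topology

universe u

namespace SemiGraph

/-- In the subdivision of a semi-graph with ACYCLIC subdivision, a walk between two branch-points at
the vertex `w` that avoids the point of `w` joins a branch-point to itself: the point of `w` separates
the points of the branches at `w`. [cite: MochizukiSemiAnbd2006, §1 p.13] -/
theorem branch_eq_of_walk_avoiding_vertex {G : SemiGraph.{u}} (hG : G.subdivision.IsAcyclic)
    {w : G.Vertex} {b b' : G.Branch} (hb : G.abuts b = some w) (hb' : G.abuts b' = some w)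
    (q : G.subdivision.Walk (Sum.inr (Sum.inr b)) (Sum.inr (Sum.inr b')))
    (hq : (Sum.inl w : G.Node) ∉ q.support) : b = b' := by
  classical
  by_contra hne
  -- the path `b — w — b'` through the point of `w`
  have h₁ : G.subdivision.Adj (Sum.inr (Sum.inr b)) (Sum.inl w) :=
    ((G.subdivision_adj_inl_iff w _).mpr ⟨b, hb, rfl⟩).symm
  have h₂ : G.subdivision.Adj (Sum.inl w) (Sum.inr (Sum.inr b')) :=
    (G.subdivision_adj_inl_iff w _).mpr ⟨b', hb', rfl⟩
  let T : G.subdivision.Walk (Sum.inr (Sum.inr b)) (Sum.inr (Sum.inr b')) :=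
    SimpleGraph.Walk.cons h₁ (SimpleGraph.Walk.cons h₂ SimpleGraph.Walk.nil)
  have hT : T.IsPath := by
    refine SimpleGraph.Walk.IsPath.mk' ?_
    have hbb' : (Sum.inr (Sum.inr b) : G.Node) ≠ Sum.inr (Sum.inr b') := by
      simpa using hne
    simp [T, hbb']
  -- uniqueness of paths: `T` is the bypass of `q`, which avoids `w`
  have huniq := hG.path_unique ⟨T, hT⟩ ⟨q.bypass, q.bypass_isPath⟩
  have hmem : (Sum.inl w : G.Node) ∈ q.bypass.support := by
    have h : (Sum.inl w : G.Node) ∈ T.support := by simp [T]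
    have e : T = q.bypass := congrArg Subtype.val huniq
    rw [e] at h
    exact h
  exact hq (q.support_bypass_subset_support hmem)

end SemiGraph

namespace ProfiniteSemiGraph

namespace GaloisLevelData

variable {𝒢 : ProfiniteSemiGraph.{u}} (D : GaloisLevelData 𝒢) (h𝒢 : 𝒢.IsCountable)

/-- **PATH TRANSPORT** (see the file header): along a `C`-fixed path of `𝔾̃_n` from `a` to `z`, both over
`w`, a `C`-fixed branch at `z` is transported to a `C`-fixed branch at `a` over the same base branch —
base subdivision acyclic, all edge groups topologically cyclic. [cite: MochizukiSemiAnbd2006, Thm 3.7(iii) p.41] -/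
theorem exists_fixed_branch_of_closed_baseWalk (n : ℕ) (C : Subgroup (D.temperedPi h𝒢))
    (hbase : 𝒢.graph.subdivision.IsAcyclic)
    (hcyc : ∀ e : 𝒢.graph.Edge, ∃ t₀ : 𝒢.Ge e, (Subgroup.zpowers t₀).topologicalClosure = ⊤)
    {w : 𝒢.graph.Vertex} (P₀ : D.PointSeq h𝒢 w) {a z : (D.tree n).Vertex}
    (haw : (D.treeProj n).vertexMap a = w) (hzw : (D.treeProj n).vertexMap z = w)
    (p : (D.tree n).subdivision.Walk (Sum.inl a) (Sum.inl z)) (hp : p.IsPath)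
    (hfix : ∀ x ∈ p.support, ∀ g ∈ C, SemiGraph.nodeMap (D.treeAct h𝒢 n g) x = x)
    (δ : (D.tree n).Branch) (hδ : (D.tree n).abuts δ = some z)
    (hδfix : ∀ g ∈ C, (D.treeAct h𝒢 n g).hom.edgeMap ((D.tree n).edgeOf δ) = (D.tree n).edgeOf δ) :
    ∃ α : (D.tree n).Branch, (D.tree n).abuts α = some a ∧
      (D.treeProj n).branchMap α = (D.treeProj n).branchMap δ ∧
      ∀ g ∈ C, (D.treeAct h𝒢 n g).hom.edgeMap ((D.tree n).edgeOf α) = (D.tree n).edgeOf α := by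
  classical
  obtain ⟨N, hN⟩ : ∃ N, p.length = N := ⟨_, rfl⟩
  induction N using Nat.strong_induction_on generalizing a p with
  | _ N ih =>
  rcases Nat.eq_zero_or_pos N with hN0 | hNpos
  · -- the trivial path: `a = z`
    subst hN0
    have haz : (Sum.inl a : (D.tree n).Node) = Sum.inl z := SimpleGraph.Walk.eq_of_length_eq_zero hN
    have haz' : a = z := Sum.inl_injective haz
    subst haz'
    exact ⟨δ, hδ, rfl, hδfix⟩
  -- a fixed branch-point gives a fixed edge
  have hfixE : ∀ β : (D.tree n).Branch, (Sum.inr (Sum.inr β) : (D.tree n).Node) ∈ p.support →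
      ∀ g ∈ C, (D.treeAct h𝒢 n g).hom.edgeMap ((D.tree n).edgeOf β) = (D.tree n).edgeOf β := by
    intro β hβ g hg
    have h := hfix _ hβ g hg
    simp only [SemiGraph.nodeMap_inr_inr, Sum.inr.injEq] at h
    rw [← (D.treeAct h𝒢 n g).hom.edgeOf_branchMap β, h]
  have hlen : 0 < p.length := hN ▸ hNpos
  -- the first step of `p`: a branch `β₁` at `a`
  have hadj₁ := p.adj_getVert_succ (i := 0) hlen
  rw [SimpleGraph.Walk.getVert_zero] at hadj₁
  obtain ⟨β₁, hβ₁a, hβ₁⟩ := ((D.tree n).subdivision_adj_inl_iff a _).mp hadj₁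
  -- the first return to a vertex over `w`
  have hex : ∃ i, 0 < i ∧ i ≤ p.length ∧ ∃ u : (D.tree n).Vertex, p.getVert i = Sum.inl u ∧
      (D.treeProj n).vertexMap u = w :=
    ⟨p.length, hlen, le_rfl, z, p.getVert_length, hzw⟩
  set i₀ := Nat.find hex with hi₀
  obtain ⟨hi₀pos, hi₀le, u₀, hu₀, hu₀w⟩ := Nat.find_spec hex
  rw [← hi₀] at hi₀pos hi₀le hu₀
  simp only [Nat.zero_add] at hadj₁ hβ₁
  have hmin : ∀ i, 0 < i → i < i₀ → ∀ u : (D.tree n).Vertex, p.getVert i = Sum.inl u →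
      (D.treeProj n).vertexMap u ≠ w := by
    intro i hi hii u hiu huw
    exact Nat.find_min hex hii ⟨hi, (le_of_lt hii).trans hi₀le, u, hiu, huw⟩
  have hi₀two : 2 ≤ i₀ := by
    rcases Nat.lt_or_ge i₀ 2 with h | h
    · exfalso
      have h1 : i₀ = 1 := by omega
      rw [h1, hβ₁] at hu₀
      simp at hu₀
    · exact h
  -- the arriving branch `β_r` at `u₀`
  have hadjr := p.adj_getVert_succ (i := i₀ - 1) (by omega)
  rw [show i₀ - 1 + 1 = i₀ by omega, hu₀] at hadjr
  obtain ⟨βr, hβru₀, hβr⟩ := ((D.tree n).subdivision_adj_inl_iff u₀ _).mp hadjr.symm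
  -- base branches
  have hb₁w : 𝒢.graph.abuts ((D.treeProj n).branchMap β₁) = some w := by
    rw [(D.treeProj n).abuts_branchMap β₁ a hβ₁a, haw]
  have hbrw : 𝒢.graph.abuts ((D.treeProj n).branchMap βr) = some w := by
    rw [(D.treeProj n).abuts_branchMap βr u₀ hβru₀, hu₀w]
  -- KEY: the first return is through the base branch of the first step
  have hkey : (D.treeProj n).branchMap βr = (D.treeProj n).branchMap β₁ := by
    -- the base walk between the two branch-points, avoiding the point of `w`
    let Φ : (D.tree n).subdivision →g 𝒢.graph.subdivision :=
      ⟨Sum.map (D.treeProj n).vertexMap (Sum.map (D.treeProj n).edgeMap (D.treeProj n).branchMap),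
        fun h => SemiGraph.subdivision_adj_map (D.treeProj n) h⟩
    let W := p.map Φ
    have hWv : ∀ j, W.getVert j = Φ (p.getVert j) := fun j => SimpleGraph.Walk.getVert_map Φ p j
    let W₁ := (W.drop 1).take (i₀ - 2)
    have hstart : W.getVert 1 = Sum.inr (Sum.inr ((D.treeProj n).branchMap β₁)) := by
      rw [hWv, hβ₁]; rfl
    have hend : (W.drop 1).getVert (i₀ - 2) = Sum.inr (Sum.inr ((D.treeProj n).branchMap βr)) := by
      rw [SimpleGraph.Walk.drop_getVert, show 1 + (i₀ - 2) = i₀ - 1 by omega, hWv, hβr]; rfl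
    let W₁' : 𝒢.graph.subdivision.Walk (Sum.inr (Sum.inr ((D.treeProj n).branchMap β₁)))
        (Sum.inr (Sum.inr ((D.treeProj n).branchMap βr))) := W₁.copy hstart hend
    have havoid : (Sum.inl w : 𝒢.graph.Node) ∉ W₁'.support := by
      intro hw
      rw [SimpleGraph.Walk.support_copy] at hw
      obtain ⟨m, hm, hmle⟩ := SimpleGraph.Walk.mem_support_iff_exists_getVert.mp hw
      rw [SimpleGraph.Walk.take_getVert, SimpleGraph.Walk.drop_getVert, hWv] at hm
      have hmle' : m ≤ i₀ - 2 := by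
        have := hmle
        rw [SimpleGraph.Walk.take_length] at this
        exact le_trans this (min_le_left _ _)
      rw [min_eq_right hmle'] at hm
      -- the node `p.getVert (1 + m)` maps to the point of `w`: it is a vertex over `w`, too early
      have hm' : Sum.map (D.treeProj n).vertexMap (Sum.map (D.treeProj n).edgeMap (D.treeProj n).branchMap)
          (p.getVert (1 + m)) = Sum.inl w := hm
      rcases hxc : p.getVert (1 + m) with u | e | c
      · rw [hxc] at hm'
        have hu : (D.treeProj n).vertexMap u = w := Sum.inl_injective hm'
        exact hmin (1 + m) (by omega) (by omega) u hxc hu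
      · rw [hxc] at hm'; simp at hm'
      · rw [hxc] at hm'; simp at hm'
    exact (SemiGraph.branch_eq_of_walk_avoiding_vertex hbase hb₁w hbrw W₁' havoid).symm
  -- the tail path from `u₀` to `z`: shorter, still `C`-fixed
  let q : (D.tree n).subdivision.Walk (Sum.inl u₀) (Sum.inl z) := (p.drop i₀).copy hu₀ rfl
  have hqlen : q.length < N := by
    rw [SimpleGraph.Walk.length_copy, SimpleGraph.Walk.drop_length]
    omega
  have hqsupp : ∀ x ∈ q.support, x ∈ p.support := by
    intro x hx
    rw [SimpleGraph.Walk.support_copy, SimpleGraph.Walk.drop_support_eq_support_drop_min] at hx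
    exact List.drop_subset _ _ hx
  have hqpath : q.IsPath := by
    refine SimpleGraph.Walk.IsPath.mk' ?_
    rw [SimpleGraph.Walk.support_copy, SimpleGraph.Walk.drop_support_eq_support_drop_min]
    exact hp.support_nodup.sublist (List.drop_sublist _ _)
  obtain ⟨β'', hβ''u₀, hβ''b, hβ''fix⟩ :=
    ih q.length hqlen hu₀w q hqpath (fun x hx => hfix x (hqsupp x hx)) rfl
  -- the local transport at `w` from `u₀` back to `a`
  obtain ⟨t₀, ht₀⟩ := hcyc (𝒢.graph.edgeOf ((D.treeProj n).branchMap β₁))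
  have hδw : 𝒢.graph.abuts ((D.treeProj n).branchMap δ) = some w := by
    rw [(D.treeProj n).abuts_branchMap δ z hδ, hzw]
  have hβ₁mem : (Sum.inr (Sum.inr β₁) : (D.tree n).Node) ∈ p.support := by
    rw [← hβ₁]; exact p.getVert_mem_support 1
  have hβrmem : (Sum.inr (Sum.inr βr) : (D.tree n).Node) ∈ p.support := by
    rw [← hβr]; exact p.getVert_mem_support (i₀ - 1)
  obtain ⟨α, hαa, hαb, hαfix⟩ := D.exists_fixed_branch_transport h𝒢 n C P₀ hb₁w hδw t₀ ht₀ haw hu₀w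
    β₁ βr β'' hβ₁a rfl hβru₀ hkey hβ''u₀ hβ''b (hfixE β₁ hβ₁mem) (hfixE βr hβrmem) hβ''fix
  exact ⟨α, hαa, hαb, hαfix⟩

end GaloisLevelData

end ProfiniteSemiGraph

end Literature.AnabelianGeometry.SemiGraphs
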